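import Mathlib
import Literature.NumberTheory.Irrationality.Brown2016.DinnerParties
import Summits.KontsevichZagierPeriods.Zeta5Search.Families.CellularIntegral
import Summits.KontsevichZagierPeriods.Zeta5Search.Families.BasicConvergence
import Summits.KontsevichZagierPeriods.Zeta5Search.Families.FastConvergence
import Summits.KontsevichZagierPeriods.Zeta5Search.Families.ChordCrossings
import Summits.KontsevichZagierPeriods.Zeta5Search.Families.BasicConvergenceGeneral
import Summits.KontsevichZagierPeriods.Zeta5Search.Families.ConvergentSeating
import Summits.KontsevichZagierPeriods.Zeta5Search.Families.ConvergentSymmetries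
import HarnessLib

/-!
# ζ(5) search — Families: convergence is a configuration-class invariant for PRINTED PLANS (`Equivalent n σ τ → (IsConvergent n σ ↔ IsConvergent n τ)`)

HONEST FRAMING: systematic search; no irrationality claim unless certified.

Cell `pub-zeta5`, seat P2.  Brown's configurations are the classes of seating plans under `D_{2n} × D_{2n}`
(`Brown2016.act` / `Brown2016.Equivalent`: reverse / rotate the positions, negate / shift the places, everything
read modulo `n`) [Brown2016, §1.5, §3.1].  The cell's enumerations certify, by kernel evaluation, that each LISTED
representative is convergent and that every convergent seating is equivalent to a listed one (`complete_reps8/9/10`).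
This file supplies the missing structural half — convergence is constant on classes — and closes the loop:
* `ofResidues L` — the 0-based reading `i ↦ L[i] mod n` of a list of residues (the normal form in which `act`/`equiv`
  compare plans); `ofSeating τ = ofResidues τ − 1` for seating plans;
* `convergent_ofResidues_iff` — for a list of length `n` with injective reading:
  `Convergent (ofResidues L) ↔ Brown2016.IsConvergent n L`; `isConvergent_map_mod_iff` (only residues matter);
* `ofResidues_act_ff/ft/tf/tt` — `act` read on `ℤ/n` is `i ↦ ±(ofResidues σ (±i + d)) + c`; hence
  `convergent_ofResidues_act_iff` from `Families/ConvergentSymmetries.lean`;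
* **`isConvergent_iff_of_equivalent`** — for a seating plan `σ` and ANY `τ` with `Equivalent n σ τ`:
  `IsConvergent n σ ↔ IsConvergent n τ` [Brown2016, §3.1: convergence is a property of the configuration];
The consequences for the lists (`IsConvergent n σ ↔ ∃ τ ∈ repsN, Equivalent n σ τ`, `5 ≤ N ≤ 10`) are in
`Families/ConfigurationClasses.lean`.
-/
namespace Summit.KontsevichZagierPeriods.Zeta5Search.Families.Cellular

open Finset Literature.NumberTheory.Irrationality.Brown2016
open Summit.KontsevichZagierPeriods.Zeta5Search.Families.Configurations (isCyclicBlock_iff)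

variable {ℓ : ℕ}

/-! ### Lists of residues read as maps on `ℤ/n` (0-based) -/

/-- 0-based reading of a list of residues: position `i ↦ L[i] mod n` (the normal form in which Brown's
`act`/`equiv` compare seating plans). -/
def ofResidues (L : List ℕ) : Fin (ℓ + 3) → Fin (ℓ + 3) :=
  fun i => ⟨L.getD i.val 0 % (ℓ + 3), Nat.mod_lt _ (by omega)⟩

/-- Value of `ofResidues`. -/
@[simp] theorem val_ofResidues (L : List ℕ) (i : Fin (ℓ + 3)) :
    ((ofResidues (ℓ := ℓ) L i : Fin (ℓ + 3)) : ℕ) = L.getD i.val 0 % (ℓ + 3) := rfl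

/-- Reducing the list modulo `n` first does not change the reading. -/
theorem ofResidues_map_mod (L : List ℕ) :
    ofResidues (ℓ := ℓ) (L.map (· % (ℓ + 3))) = ofResidues L := by
  funext i
  apply Fin.ext
  simp only [val_ofResidues]
  have : (L.map (· % (ℓ + 3))).getD i.val 0 = (L.getD i.val 0) % (ℓ + 3) := by
    have h := List.getD_map (f := fun x : ℕ => x % (ℓ + 3)) (l := L) (n := i.val) (d := 0)
    simpa using h
  rw [this, Nat.mod_mod]

section Residues

open Fin.NatCast Fin.CommRing

/-- `ofResidues L i` is the cast of the entry: `(L[i] : ℤ/n)`. -/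
theorem ofResidues_eq_natCast (L : List ℕ) (i : Fin (ℓ + 3)) :
    ofResidues (ℓ := ℓ) L i = ((L.getD i.val 0 : ℕ) : Fin (ℓ + 3)) :=
  Fin.ext (by simp [Fin.val_natCast])

/-- For a seating plan (guests `1,…,n`), Brown's 1-based reading `ofSeating` is the 0-based reading shifted by one
place: `ofSeating τ i = ofResidues τ i − 1`. -/
theorem ofSeating_eq_ofResidues_sub_one {τ : List ℕ} (hτ : IsSeating (ℓ + 3) τ) (i : Fin (ℓ + 3)) :
    ofSeating (ℓ := ℓ) τ i = ofResidues τ i - 1 := by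
  rw [ofSeating_eq_sub_one hτ, ofResidues_eq_natCast]

/-- Casting a residue: `((a mod n : ℕ) : ℤ/n) = (a : ℤ/n)`. -/
theorem natCast_mod_eq (a : ℕ) : (((a % (ℓ + 3) : ℕ)) : Fin (ℓ + 3)) = (a : Fin (ℓ + 3)) :=
  Fin.ext (by simp [Fin.val_natCast])

/-! ### The residue-level bridge `Convergent (ofResidues L) ↔ IsConvergent n L` -/

/-- Windows of a list of length `n`, as entries. -/
theorem mem_window_iff_of_length {L : List ℕ} (hL : L.length = ℓ + 3) (s k : ℕ) {x : ℕ} :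
    x ∈ window L s k ↔ ∃ j : ℕ, j < k ∧ x = L.getD ((s + j) % (ℓ + 3)) 0 := by
  unfold window
  rw [hL]
  simp only [List.mem_map, List.mem_range]
  constructor
  · rintro ⟨j, hj, rfl⟩
    exact ⟨j, hj, rfl⟩
  · rintro ⟨j, hj, rfl⟩
    exact ⟨j, hj, rfl⟩

/-- Condition (ii) of Brown's block test on a window of `L` ⟺ `ofResidues L` seats the arc of positions into the arc
of places starting at `a'`. -/
theorem window_subset_block_iff_ofResidues {L : List ℕ} (hL : L.length = ℓ + 3) (s : Fin (ℓ + 3)) {k : ℕ}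
    (hk : k ≤ ℓ + 3) (a' : ℕ) :
    (∀ x ∈ window L s k, x % (ℓ + 3) ∈ (List.range (window L s k).length).map fun j => (a' + j) % (ℓ + 3)) ↔
      ∀ i : Fin (ℓ + 3), i ∈ arc s k → ofResidues (ℓ := ℓ) L i ∈ arc (a' : Fin (ℓ + 3)) k := by
  rw [length_window]
  simp only [List.mem_map, List.mem_range, mem_window_iff_of_length hL]
  constructor
  · intro h i hi
    rw [mem_arc_iff_exists hk] at hi
    obtain ⟨j, hj, rfl⟩ := hi
    obtain ⟨m, hm, hmod⟩ := h _ ⟨j, hj, rfl⟩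
    rw [mem_arc_iff_exists hk]
    refine ⟨m, hm, ?_⟩
    rw [ofResidues_eq_natCast, val_add_natCast, (natCast_eq_add_iff _ _ _).2 hmod.symm]
  · intro h x ⟨j, hj, hx⟩
    subst hx
    have hi : s + (j : Fin (ℓ + 3)) ∈ arc s k := (mem_arc_iff_exists hk).2 ⟨j, hj, rfl⟩
    have := h _ hi
    rw [mem_arc_iff_exists hk] at this
    obtain ⟨m, hm, hm'⟩ := this
    rw [ofResidues_eq_natCast, val_add_natCast] at hm'
    exact ⟨m, hm, ((natCast_eq_add_iff _ _ _).1 hm').symm⟩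

/-- Pigeonhole: if the reading `ofResidues L` is injective and the `k ≤ n` entries of a window lie in a block of `k`
consecutive residues, they exhaust it. -/
theorem block_subset_window_ofResidues {L : List ℕ} (hL : L.length = ℓ + 3)
    (hinj : Function.Injective (ofResidues (ℓ := ℓ) L)) (s : Fin (ℓ + 3)) {k : ℕ} (hk : k ≤ ℓ + 3) (a' : ℕ)
    (h : ∀ x ∈ window L s k, x % (ℓ + 3) ∈ (List.range (window L s k).length).map fun j => (a' + j) % (ℓ + 3)) :
    ∀ j < (window L s k).length, (a' + j) % (ℓ + 3) ∈ (window L s k).map (· % (ℓ + 3)) := by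
  have hblock := (window_subset_block_iff_ofResidues hL s hk a').1 h
  rw [length_window]
  simp only [List.mem_map, mem_window_iff_of_length hL]
  -- the offset map `arc s k → range k`, `i ↦ (ofResidues L i − a')`, is injective, hence onto
  have hsurj := Finset.surj_on_of_inj_on_of_card_le (s := arc s k) (t := range k)
    (fun i _ => (((ofResidues (ℓ := ℓ) L i) - (a' : Fin (ℓ + 3)) : Fin (ℓ + 3)) : ℕ)) ?_ ?_
    (by rw [card_range, card_arc s hk])
  · intro m hm
    obtain ⟨i, hi, him⟩ := hsurj m (mem_range.2 hm)
    rw [mem_arc_iff_exists hk] at hi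
    obtain ⟨j, hj, rfl⟩ := hi
    refine ⟨L.getD (((s : ℕ) + j) % (ℓ + 3)) 0, ⟨j, hj, rfl⟩, ?_⟩
    have h1 : ofResidues (ℓ := ℓ) L (s + (j : Fin (ℓ + 3))) - (a' : Fin (ℓ + 3)) = (m : Fin (ℓ + 3)) :=
      Fin.ext (by rw [Fin.val_cast_of_lt (by omega), him])
    have h2 : ofResidues (ℓ := ℓ) L (s + (j : Fin (ℓ + 3))) = (a' : Fin (ℓ + 3)) + (m : Fin (ℓ + 3)) := by
      rw [← h1]
      abel
    rw [ofResidues_eq_natCast, val_add_natCast] at h2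
    exact (natCast_eq_add_iff _ _ _).1 h2
  · intro i hi
    have := hblock i (mem_coe.1 hi)
    rw [mem_arc] at this
    exact mem_coe.2 (mem_range.2 this)
  · intro i₁ i₂ _ _ heq
    apply hinj
    have := Fin.ext heq
    simpa using this

/-- The two convergence conditions agree on the atoms, for an injective reading of a list of length `n`:
`WindowInBlock (ofResidues L) s k ↔ isCyclicBlock n (window L s k)` (`k ≤ n`). [Brown2016, §1.5, §3.1] -/
theorem windowInBlock_ofResidues_iff {L : List ℕ} (hL : L.length = ℓ + 3)
    (hinj : Function.Injective (ofResidues (ℓ := ℓ) L)) (s : Fin (ℓ + 3)) {k : ℕ} (hk : k ≤ ℓ + 3) :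
    WindowInBlock (ofResidues (ℓ := ℓ) L) s k ↔ isCyclicBlock (ℓ + 3) (window L s k) = true := by
  rw [isCyclicBlock_iff]
  constructor
  · rintro ⟨a, ha⟩
    have ha' : ∀ i : Fin (ℓ + 3), i ∈ arc s k → ofResidues (ℓ := ℓ) L i ∈ arc (((a : ℕ) : Fin (ℓ + 3))) k := by
      simpa using ha
    exact ⟨(a : ℕ), a.isLt, block_subset_window_ofResidues hL hinj s hk _
      ((window_subset_block_iff_ofResidues hL s hk _).2 ha'), (window_subset_block_iff_ofResidues hL s hk _).2 ha'⟩
  · rintro ⟨a', -, -, h2⟩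
    exact ⟨_, (window_subset_block_iff_ofResidues hL s hk a').1 h2⟩

end Residues

/-- **Residue-level bridge**: for a list `L` of length `n` with injective reading (distinct residues),
`Convergent (ofResidues L) ↔ Brown2016.IsConvergent n L`. [Brown2016, §1.5, §3.1] -/
theorem convergent_ofResidues_iff {L : List ℕ} (hL : L.length = ℓ + 3)
    (hinj : Function.Injective (ofResidues (ℓ := ℓ) L)) :
    Convergent (ofResidues (ℓ := ℓ) L) ↔ IsConvergent (ℓ + 3) L := by
  unfold Convergent IsConvergent isConvergent
  simp only [List.all_eq_true, List.mem_range, Bool.not_eq_true', Nat.add_sub_cancel]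
  constructor
  · intro h k' hk' i hi
    have := h ⟨i, hi⟩ (k' + 2) (by omega) (by omega)
    rw [windowInBlock_ofResidues_iff hL hinj _ (by omega)] at this
    simpa using this
  · intro h s k hk hk2 hw
    rw [windowInBlock_ofResidues_iff hL hinj _ (by omega)] at hw
    have := h (k - 2) (by omega) s s.isLt
    rw [show k - 2 + 2 = k by omega] at this
    rw [this] at hw
    exact Bool.false_ne_true hw

/-- `IsConvergent` only depends on the residues of the list. -/
theorem isConvergent_map_mod_iff (L : List ℕ) :
    IsConvergent (ℓ + 3) (L.map (· % (ℓ + 3))) ↔ IsConvergent (ℓ + 3) L := by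
  have hw : ∀ s k, window (L.map (· % (ℓ + 3))) s k = (window L s k).map (· % (ℓ + 3)) := by
    intro s k
    unfold window
    rw [List.length_map, List.map_map]
    refine List.map_congr_left fun j _ => ?_
    have h := List.getD_map (f := fun x : ℕ => x % (ℓ + 3)) (l := L) (n := (s + j) % L.length) (d := 0)
    simpa using h
  have hb : ∀ S : List ℕ, isCyclicBlock (ℓ + 3) (S.map (· % (ℓ + 3))) = isCyclicBlock (ℓ + 3) S := by
    intro S
    unfold isCyclicBlock
    simp [List.map_map, Function.comp_def, List.all_map]
  unfold IsConvergent isConvergent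
  simp only [hw, hb]

/-! ### Brown's symmetries `act` read on `ℤ/n` -/

section Act

open Fin.NatCast Fin.CommRing

/-- Entries of `act`: position `i` of `act n pr r vn c σ` holds `((±σ[pos] mod n) + c) mod n` with
`pos = (i + r) mod n` (or its mirror image `n − 1 − (i + r) mod n` if the positions are reversed). -/
theorem getD_act {σ : List ℕ} (hσ : σ.length = ℓ + 3) (pr : Bool) (r : ℕ) (vn : Bool) (c : ℕ) (i : Fin (ℓ + 3)) :
    (act (ℓ + 3) pr r vn c σ).getD i.val 0 =
      ((if vn then (ℓ + 3) - σ.getD (if pr then (ℓ + 3) - 1 - (i.val + r) % (ℓ + 3) else (i.val + r) % (ℓ + 3)) 0 % (ℓ + 3)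
        else σ.getD (if pr then (ℓ + 3) - 1 - (i.val + r) % (ℓ + 3) else (i.val + r) % (ℓ + 3)) 0 % (ℓ + 3)) + c) %
        (ℓ + 3) := by
  have hi := i.isLt
  have hlen' : ((if pr then σ.reverse else σ).rotate r).length = ℓ + 3 := by
    cases pr <;> simp [hσ]
  unfold act
  rw [List.getD_eq_getElem _ _ (by rw [List.length_map, hlen']; exact hi), List.getElem_map,
    List.getElem_rotate]
  cases pr with
  | false =>
    simp only [Bool.false_eq_true, ↓reduceIte, hσ]
    rw [List.getD_eq_getElem _ _ (by rw [hσ]; exact Nat.mod_lt _ (by omega))]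
  | true =>
    simp only [↓reduceIte, List.length_reverse, hσ]
    rw [List.getElem_reverse, List.getD_eq_getElem _ _ (by rw [hσ]; have := Nat.mod_lt (i.val + r) (show 0 < ℓ + 3 by omega); omega)]
    simp only [hσ]

/-- The position read by `act` in the mirrored case, as an element of `ℤ/n`: `n − 1 − (i + r) = d − i` with
`d = (n−1) − r`. -/
theorem mirror_pos_eq (r : ℕ) (i : Fin (ℓ + 3)) :
    ((((ℓ + 3) - 1 - (i.val + r) % (ℓ + 3) : ℕ)) : Fin (ℓ + 3)) =
      ((((ℓ + 3 - 1 : ℕ)) : Fin (ℓ + 3)) - (r : Fin (ℓ + 3))) - i := by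
  have hm : (i.val + r) % (ℓ + 3) ≤ ℓ + 3 - 1 := by have := Nat.mod_lt (i.val + r) (show 0 < ℓ + 3 by omega); omega
  rw [Nat.cast_sub hm, natCast_mod_eq, Nat.cast_add, Fin.cast_val_eq_self]
  abel

/-- `act` with positions kept, places rotated: `ofResidues (act n false r false c σ) = (ofResidues σ ∘ (· + r)) + c`. -/
theorem ofResidues_act_ff {σ : List ℕ} (hσ : σ.length = ℓ + 3) (r c : ℕ) :
    ofResidues (ℓ := ℓ) (act (ℓ + 3) false r false c σ) =
      fun i => ofResidues (ℓ := ℓ) σ (i + (r : Fin (ℓ + 3))) + (c : Fin (ℓ + 3)) := by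
  funext i
  apply Fin.ext
  rw [val_ofResidues, getD_act hσ, Fin.val_add, val_ofResidues, val_add_natCast, Fin.val_natCast]
  simp only [Bool.false_eq_true, ↓reduceIte, Nat.mod_mod, Nat.add_mod_mod]

/-- `act` with positions kept, places reflected: `ofResidues (act n false r true c σ) = c − ofResidues σ ∘ (· + r)`. -/
theorem ofResidues_act_ft {σ : List ℕ} (hσ : σ.length = ℓ + 3) (r c : ℕ) :
    ofResidues (ℓ := ℓ) (act (ℓ + 3) false r true c σ) =
      fun i => (c : Fin (ℓ + 3)) - ofResidues (ℓ := ℓ) σ (i + (r : Fin (ℓ + 3))) := by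
  funext i
  apply Fin.ext
  rw [val_ofResidues, getD_act hσ, Fin.sub_def]
  simp only [Bool.false_eq_true, ↓reduceIte, val_ofResidues, val_add_natCast, Fin.val_natCast, Nat.mod_mod,
    Nat.add_mod_mod]

/-- `act` with positions reversed, places rotated. -/
theorem ofResidues_act_tf {σ : List ℕ} (hσ : σ.length = ℓ + 3) (r c : ℕ) :
    ofResidues (ℓ := ℓ) (act (ℓ + 3) true r false c σ) =
      fun i => ofResidues (ℓ := ℓ) σ (((((ℓ + 3 - 1 : ℕ)) : Fin (ℓ + 3)) - (r : Fin (ℓ + 3))) - i) + (c : Fin (ℓ + 3)) := by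
  funext i
  apply Fin.ext
  have hpos : (((((ℓ + 3 - 1 : ℕ)) : Fin (ℓ + 3)) - (r : Fin (ℓ + 3))) - i : Fin (ℓ + 3)).val =
      (ℓ + 3) - 1 - (i.val + r) % (ℓ + 3) := by
    rw [← mirror_pos_eq r i, Fin.val_cast_of_lt (by omega)]
  rw [val_ofResidues, getD_act hσ, Fin.val_add, val_ofResidues, hpos, Fin.val_natCast]
  simp only [↓reduceIte, Bool.false_eq_true, Nat.mod_mod, Nat.add_mod_mod]

/-- `act` with positions reversed, places reflected. -/
theorem ofResidues_act_tt {σ : List ℕ} (hσ : σ.length = ℓ + 3) (r c : ℕ) :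
    ofResidues (ℓ := ℓ) (act (ℓ + 3) true r true c σ) =
      fun i => (c : Fin (ℓ + 3)) - ofResidues (ℓ := ℓ) σ (((((ℓ + 3 - 1 : ℕ)) : Fin (ℓ + 3)) - (r : Fin (ℓ + 3))) - i) := by
  funext i
  apply Fin.ext
  have hpos : (((((ℓ + 3 - 1 : ℕ)) : Fin (ℓ + 3)) - (r : Fin (ℓ + 3))) - i : Fin (ℓ + 3)).val =
      (ℓ + 3) - 1 - (i.val + r) % (ℓ + 3) := by
    rw [← mirror_pos_eq r i, Fin.val_cast_of_lt (by omega)]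
  rw [val_ofResidues, getD_act hσ, Fin.sub_def]
  simp only [↓reduceIte, val_ofResidues, hpos, Fin.val_natCast, Nat.mod_mod, Nat.add_mod_mod]

/-- **Brown's symmetries preserve convergence of the reading**: for a list `σ` of length `n` and any element of
`D_{2n} × D_{2n}`, `Convergent (ofResidues (act … σ)) ↔ Convergent (ofResidues σ)`. [Brown2016, §3.1 (3.4)–(3.5)] -/
theorem convergent_ofResidues_act_iff {σ : List ℕ} (hσ : σ.length = ℓ + 3) (pr : Bool) (r : ℕ) (vn : Bool) (c : ℕ) :
    Convergent (ofResidues (ℓ := ℓ) (act (ℓ + 3) pr r vn c σ)) ↔ Convergent (ofResidues (ℓ := ℓ) σ) := by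
  cases pr <;> cases vn
  · rw [ofResidues_act_ff hσ, convergent_add_iff (fun i => ofResidues (ℓ := ℓ) σ (i + (r : Fin (ℓ + 3)))),
      convergent_comp_add_iff]
  · rw [ofResidues_act_ft hσ, convergent_sub_iff (fun i => ofResidues (ℓ := ℓ) σ (i + (r : Fin (ℓ + 3)))),
      convergent_comp_add_iff]
  · rw [ofResidues_act_tf hσ, convergent_add_iff (fun i => ofResidues (ℓ := ℓ) σ (_ - i)),
      convergent_comp_sub_iff]
  · rw [ofResidues_act_tt hσ, convergent_sub_iff (fun i => ofResidues (ℓ := ℓ) σ (_ - i)),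
      convergent_comp_sub_iff]

/-- The symmetries also preserve injectivity of the reading. -/
theorem injective_ofResidues_act {σ : List ℕ} (hσ : σ.length = ℓ + 3)
    (hinj : Function.Injective (ofResidues (ℓ := ℓ) σ)) (pr : Bool) (r : ℕ) (vn : Bool) (c : ℕ) :
    Function.Injective (ofResidues (ℓ := ℓ) (act (ℓ + 3) pr r vn c σ)) := by
  cases pr <;> cases vn
  · rw [ofResidues_act_ff hσ]
    intro i j h
    have := hinj (add_right_cancel h)
    simpa using this
  · rw [ofResidues_act_ft hσ]
    intro i j h
    have := hinj (sub_right_injective h)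
    simpa using this
  · rw [ofResidues_act_tf hσ]
    intro i j h
    have := hinj (add_right_cancel h)
    simpa using this
  · rw [ofResidues_act_tt hσ]
    intro i j h
    have := hinj (sub_right_injective h)
    simpa using this

/-- Length of `act`. -/
theorem length_act {σ : List ℕ} (hσ : σ.length = ℓ + 3) (pr : Bool) (r : ℕ) (vn : Bool) (c : ℕ) :
    (act (ℓ + 3) pr r vn c σ).length = ℓ + 3 := by
  unfold act
  cases pr <;> simp [hσ]

end Act

/-! ### Equivalent plans have the same convergence -/

/-- Unpacking `Equivalent`: some element of `D_{2n} × D_{2n}` carries `σ` to `τ mod n`. -/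
theorem exists_act_eq_of_equivalent {σ τ : List ℕ} (h : Equivalent (ℓ + 3) σ τ) :
    ∃ (pr : Bool) (r : ℕ) (vn : Bool) (c : ℕ), act (ℓ + 3) pr r vn c σ = τ.map (· % (ℓ + 3)) := by
  unfold Equivalent equiv at h
  simp only [List.any_eq_true, List.mem_cons, List.mem_range, beq_iff_eq] at h
  obtain ⟨pr, -, r, -, vn, -, c, -, hact⟩ := h
  exact ⟨pr, r, vn, c, hact⟩

/-- For a seating plan the 0-based reading is injective. -/
theorem injective_ofResidues_of_isSeating {τ : List ℕ} (hτ : IsSeating (ℓ + 3) τ) :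
    Function.Injective (ofResidues (ℓ := ℓ) τ) := by
  intro i j hij
  apply bijective_ofSeating hτ |>.injective
  rw [ofSeating_eq_ofResidues_sub_one hτ, ofSeating_eq_ofResidues_sub_one hτ, hij]

/-- **Convergence is an invariant of Brown's configurations, at the level of printed plans**: if `σ` is a seating
plan of `n` guests and `τ` is any list equivalent to it under `D_{2n} × D_{2n}` (`Brown2016.Equivalent`), then
`IsConvergent n σ ↔ IsConvergent n τ`. [Brown2016, §1.5 ("we call the equivalence class a configuration"), §3.1] -/
theorem isConvergent_iff_of_equivalent {σ τ : List ℕ} (hσ : IsSeating (ℓ + 3) σ) (h : Equivalent (ℓ + 3) σ τ) :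
    IsConvergent (ℓ + 3) σ ↔ IsConvergent (ℓ + 3) τ := by
  obtain ⟨pr, r, vn, c, hact⟩ := exists_act_eq_of_equivalent h
  have hlen := length_of_isSeating hσ
  have hinj := injective_ofResidues_of_isSeating hσ
  rw [← isConvergent_map_mod_iff τ, ← hact,
    ← convergent_ofResidues_iff (length_act hlen pr r vn c) (injective_ofResidues_act hlen hinj pr r vn c),
    convergent_ofResidues_act_iff hlen, convergent_ofResidues_iff hlen hinj]

end Summit.KontsevichZagierPeriods.Zeta5Search.Families.Cellular
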